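import Summits.CriticalPhenomena.SAWScalingLimit.Theorems.SAWRenewalTightnessTubeLowerBoundCornerStaircaseHelpers

/-!
# Crux `TubeLowerBound` (stmt-CriticalPhenomena-4730), line `lieb-simon-star`: the corner staircase (stub S4b)

`stub_cornerStaircase : HalfTubePieceFloor → FirstOctantTubeFloor`.  From the one-sided flat pieces of
`HalfTubePieceFloor` (self-avoiding walks `0 → (L, 0)` inside `[0, L] × [0, L/10]`, `x_c`-mass `≥ c L^{-C}`) a lattice
staircase `0 → v = (a, b)`, `0 ≤ b ≤ a`, is glued in `n = min(20, a)` rounds through the corners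
`Q_j = (x_j, y_j) = (⌊j a/n⌋, ⌊j b/n⌋)`: round `j + 1` is a horizontal block (piece of parameter `x_{j+1} − x_j − 1` and its
east connector edge) to `(x_{j+1}, y_j)`, then, if `y_{j+1} > y_j`, a vertical block (swapped piece and north edge) to
`Q_{j+1}`.  Consecutive blocks are separated by a column or a row (`stairSet`, `midSet` bound the swept region), so
`tubeMass_concat` applies `2n` times with self-avoidance for free; every vertex is within `a/10 + 2 ≤ ℓ₀/10 + 2` of
`[0, v]` (`tube_of_H`, `tube_of_V`); the mass multiplies to `((x_c min(c,1) ℓ₀^{-C})²)^n ≥ (x_c min(c,1))^{40} ℓ₀^{-40C}`.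
For `a < 20` (`n = a`) every piece is trivial (the digital staircase of unit steps); `a = 0` is the trivial walk.
-/

noncomputable section

namespace Summit.CriticalPhenomena.SAWScalingLimit.Theorems.TubeLowerBound.LiebSimonStar

open scoped BigOperators Classical
open Literature.Probability.LatticeModels
open Literature.Probability.RandomPlanarGeometry Literature.Probability.RandomPlanarGeometry.SAW
open Literature.Probability.Percolation.Contour (site_ext)

namespace CornerStaircase

/-! ### The corners of the staircase -/

/-- Number of rounds of the staircase to `(a, b)`: `n = min(20, a)`. -/
def nR (a : ℕ) : ℕ := min 20 a

/-- Abscissa `x_j = ⌊j a / n⌋` of the `j`-th corner. -/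
def xc (a j : ℕ) : ℕ := j * a / nR a

/-- Ordinate `y_j = ⌊j b / n⌋` of the `j`-th corner. -/
def yc (a b j : ℕ) : ℕ := j * b / nR a

/-- The last corner is `(a, b)`. -/
theorem xc_yc_nR {a b : ℕ} (hba : b ≤ a) : xc a (nR a) = a ∧ yc a b (nR a) = b := by
  unfold xc yc
  rcases Nat.eq_zero_or_pos (nR a) with h | h
  · have hb : a = 0 ∧ b = 0 := by unfold nR at h; omega
    simp [hb]
  · exact ⟨Nat.mul_div_cancel_left a h, Nat.mul_div_cancel_left b h⟩

/-- Integer bookkeeping for round `j + 1 ≤ n`, with `q = ⌊a/n⌋ ≥ 1`: `x_j + q ≤ x_{j+1}`, `x_{j+1} + q ≤ x_{j+2}`,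
`y_j ≤ y_{j+1} ≤ y_j + q + 1`, `x_{j+1} ≤ a` (and `q ≤ a`). -/
theorem corner_facts {a b j : ℕ} (hba : b ≤ a) (hj : j + 1 ≤ nR a) :
    1 ≤ a / nR a ∧ a / nR a ≤ a ∧ xc a j + a / nR a ≤ xc a (j + 1) ∧
      xc a (j + 1) + a / nR a ≤ xc a (j + 1 + 1) ∧ yc a b j ≤ yc a b (j + 1) ∧
      yc a b (j + 1) ≤ yc a b j + a / nR a + 1 ∧ xc a (j + 1) ≤ a := by
  have hn : 0 < nR a := by omega
  have hna : nR a ≤ a := min_le_right _ _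
  refine ⟨(Nat.le_div_iff_mul_le hn).2 (by simpa using hna), Nat.div_le_self _ _, ?_, ?_,
    Nat.div_le_div_right (Nat.mul_le_mul_right b (Nat.le_succ j)), ?_, ?_⟩
  · have h := Nat.add_div_le_add_div (j * a) a (nR a)
    rwa [show j * a + a = (j + 1) * a by ring] at h
  · have h := Nat.add_div_le_add_div ((j + 1) * a) a (nR a)
    rwa [show (j + 1) * a + a = (j + 1 + 1) * a by ring] at h
  · have h1 : (j * b + b) / nR a ≤ j * b / nR a + b / nR a + 1 := by
      rw [Nat.add_div hn]
      split_ifs <;> omega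
    have h2 : b / nR a ≤ a / nR a := Nat.div_le_div_right hba
    rw [show j * b + b = (j + 1) * b by ring] at h1
    unfold yc
    omega
  · calc xc a (j + 1) = (j + 1) * a / nR a := rfl
      _ ≤ nR a * a / nR a := Nat.div_le_div_right (Nat.mul_le_mul_right a hj)
      _ = a := Nat.mul_div_cancel_left a hn

/-- The corners in `ℝ`: `x_j ∈ (j a/n − 1, j a/n]` and `y_j ∈ (j b/n − 1, j b/n]` (floor division). -/
theorem corner_real (a b j : ℕ) (hn : 0 < nR a) :
    (((xc a j : ℕ) : ℝ) ≤ (j : ℝ) / nR a * a ∧ (j : ℝ) / nR a * a - 1 < ((xc a j : ℕ) : ℝ)) ∧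
      (((yc a b j : ℕ) : ℝ) ≤ (j : ℝ) / nR a * b ∧ (j : ℝ) / nR a * b - 1 < ((yc a b j : ℕ) : ℝ)) := by
  have hn' : (0 : ℝ) < nR a := by exact_mod_cast hn
  have key : ∀ m : ℕ, ((m / nR a : ℕ) : ℝ) ≤ (m : ℝ) / nR a ∧ (m : ℝ) / nR a - 1 < ((m / nR a : ℕ) : ℝ) := by
    refine fun m => ⟨Nat.cast_div_le, ?_⟩
    rw [sub_lt_iff_lt_add, div_lt_iff₀ hn']
    calc (m : ℝ) < ((m / nR a * nR a + nR a : ℕ) : ℝ) := by exact_mod_cast Nat.lt_div_mul_add hn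
      _ = (((m / nR a : ℕ) : ℝ) + 1) * nR a := by push_cast; ring
  have e1 : ((j * a : ℕ) : ℝ) / (nR a : ℕ) = (j : ℝ) / nR a * a := by push_cast; ring
  have e2 : ((j * b : ℕ) : ℝ) / (nR a : ℕ) = (j : ℝ) / nR a * b := by push_cast; ring
  exact ⟨e1 ▸ key (j * a), e2 ▸ key (j * b)⟩

/-- With `α = a/n`, `n = min(20, a)`, `a ≥ 1`: `1 ≤ α` and `11 α ≤ a + 10` (the two regimes `n = a` and
`n = 20`). -/
theorem alpha_facts {a : ℕ} (ha : 1 ≤ a) :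
    1 ≤ (a : ℝ) / nR a ∧ 11 * ((a : ℝ) / nR a) ≤ a + 10 := by
  have ha' : (1 : ℝ) ≤ a := by exact_mod_cast ha
  unfold nR
  rcases le_total a 20 with h | h
  · rw [min_eq_right h, div_self (by positivity)]
    constructor <;> linarith
  · rw [min_eq_left h]
    have h' : (20 : ℝ) ≤ a := by exact_mod_cast h
    push_cast
    exact ⟨by rw [le_div_iff₀ (by norm_num)]; linarith, by linarith⟩

/-- `a ≤ ℓ₀ = max(1, |(a, b)|)`. -/
theorem cast_le_ell0 (a b : ℕ) :
    (a : ℝ) ≤ max 1 (dist (Site.toComplex (0 : Site 2)) (Site.toComplex (![(a : ℤ), (b : ℤ)] : Site 2))) := by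
  refine le_trans ?_ (le_max_right _ _)
  rw [Complex.dist_eq]
  refine le_trans (le_of_eq ?_) (Complex.abs_re_le_norm _)
  simp

/-! ### Regions -/

/-- The tube of `FirstOctantTubeFloor` at `(a, b)`: lattice points within `ℓ₀/10 + 2` of the segment
`[0, (a, b)]`. -/
def tubeSet (a b : ℕ) : Set (Site 2) :=
  {p | Metric.infDist (Site.toComplex p)
      (segment ℝ (Site.toComplex (0 : Site 2)) (Site.toComplex (![(a : ℤ), (b : ℤ)] : Site 2))) ≤
    max 1 (dist (Site.toComplex (0 : Site 2)) (Site.toComplex (![(a : ℤ), (b : ℤ)] : Site 2))) / 10 + 2}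

/-- Outer bound, by columns and rows, of the region swept by the first `j` rounds: left of column `x_j`, or
left of column `x_{j+1}` and below row `y_j`, or the corner `(x_j, y_j)` itself. -/
def stairSet (a b j : ℕ) : Set (Site 2) :=
  {p | p 0 + 1 ≤ xc a j ∨ (p 0 + 1 ≤ xc a (j + 1) ∧ p 1 + 1 ≤ yc a b j) ∨
    (p 0 = xc a j ∧ p 1 = yc a b j)}

/-- The same after the horizontal block of round `j + 1`: left of column `x_{j+1}`, or the point
`(x_{j+1}, y_j)`. -/
def midSet (a b j : ℕ) : Set (Site 2) :=
  {p | p 0 + 1 ≤ xc a (j + 1) ∨ (p 0 = xc a (j + 1) ∧ p 1 = yc a b j)}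

/-- The origin lies in the tube. -/
theorem zero_mem_tubeSet (a b : ℕ) : (0 : Site 2) ∈ tubeSet a b := by
  show Metric.infDist _ _ ≤ _
  rw [Metric.infDist_zero_of_mem (left_mem_segment ℝ _ _)]
  positivity

/-! ### The tube test for the two blocks of round `j + 1` -/

/-- Vertices of the horizontal block of round `j + 1` (columns `[x_j, x_{j+1}]`, rows
`[y_j, y_j + (x_{j+1} − x_j − 1)/10]`) lie in the tube: compare with the point of parameter `j/n` of the
segment. -/
theorem tube_of_H {a b j : ℕ} (hj : j + 1 ≤ nR a) {p : Site 2}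
    (h0 : ((xc a j : ℕ) : ℤ) ≤ p 0) (h0' : p 0 ≤ xc a (j + 1)) (h1 : ((yc a b j : ℕ) : ℤ) ≤ p 1)
    (h1' : 10 * (p 1 - yc a b j) + xc a j + 1 ≤ xc a (j + 1)) : p ∈ tubeSet a b := by
  have hn : 0 < nR a := by omega
  have ha : 1 ≤ a := le_trans (by omega : 1 ≤ nR a) (min_le_right 20 a)
  have hn' : (0 : ℝ) < nR a := by exact_mod_cast hn
  obtain ⟨hα1, hα⟩ := alpha_facts ha
  obtain ⟨⟨hX, hX'⟩, ⟨hY, hY'⟩⟩ := corner_real a b j hn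
  obtain ⟨⟨hX1, -⟩, -⟩ := corner_real a b (j + 1) hn
  have e1 : ((j + 1 : ℕ) : ℝ) / nR a * a = (j : ℝ) / nR a * a + a / nR a := by push_cast; ring
  rw [e1] at hX1
  have r0 : ((xc a j : ℕ) : ℝ) ≤ ((p 0 : ℤ) : ℝ) := by exact_mod_cast h0
  have r0' : ((p 0 : ℤ) : ℝ) ≤ ((xc a (j + 1) : ℕ) : ℝ) := by exact_mod_cast h0'
  have r1 : ((yc a b j : ℕ) : ℝ) ≤ ((p 1 : ℤ) : ℝ) := by exact_mod_cast h1
  have r1' : 10 * (((p 1 : ℤ) : ℝ) - ((yc a b j : ℕ) : ℝ)) + ((xc a j : ℕ) : ℝ) + 1 ≤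
      ((xc a (j + 1) : ℕ) : ℝ) := by exact_mod_cast h1'
  have hℓ := cast_le_ell0 a b
  have key := infDist_segment_le_coord a b p ((j : ℝ) / nR a) (by positivity)
    (by rw [div_le_one hn']; exact_mod_cast (by omega : j ≤ nR a))
  refine key.trans ?_
  have A : |((p 0 : ℤ) : ℝ) - (j : ℝ) / nR a * a| ≤ (a : ℝ) / nR a := by
    rw [abs_le]; constructor <;> linarith
  have B : |((p 1 : ℤ) : ℝ) - (j : ℝ) / nR a * b| ≤ 1 + (a : ℝ) / nR a / 10 := by
    rw [abs_le]; constructor <;> linarith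
  linarith

/-- Vertices of the vertical block of round `j + 1` (columns `[x_{j+1}, x_{j+1} + (y_{j+1} − y_j − 1)/10]`,
rows `[y_j, y_{j+1}]`) lie in the tube: compare with the point of abscissa `x_{j+1}` of the segment. -/
theorem tube_of_V {a b j : ℕ} (hba : b ≤ a) (hj : j + 1 ≤ nR a) {p : Site 2}
    (h0 : ((xc a (j + 1) : ℕ) : ℤ) ≤ p 0)
    (h0' : 10 * (p 0 - xc a (j + 1)) + yc a b j + 1 ≤ yc a b (j + 1))
    (h1 : ((yc a b j : ℕ) : ℤ) ≤ p 1) (h1' : p 1 ≤ yc a b (j + 1)) : p ∈ tubeSet a b := by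
  have hn : 0 < nR a := by omega
  have ha : 1 ≤ a := le_trans (by omega : 1 ≤ nR a) (min_le_right 20 a)
  have ha0 : (0 : ℝ) < a := by exact_mod_cast ha
  have ha0' : (a : ℝ) ≠ 0 := ha0.ne'
  have hn0' : ((nR a : ℕ) : ℝ) ≠ 0 := by exact_mod_cast hn.ne'
  have hba' : (b : ℝ) ≤ a := by exact_mod_cast hba
  obtain ⟨hα1, hα⟩ := alpha_facts ha
  obtain ⟨-, ⟨-, hY'⟩⟩ := corner_real a b j hn
  obtain ⟨⟨hX1, hX1'⟩, ⟨hY1, -⟩⟩ := corner_real a b (j + 1) hn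
  have e1 : ((j + 1 : ℕ) : ℝ) / nR a * a = (j : ℝ) / nR a * a + a / nR a := by push_cast; ring
  have e2 : ((j + 1 : ℕ) : ℝ) / nR a * b = (j : ℝ) / nR a * b + b / nR a := by push_cast; ring
  rw [e1] at hX1 hX1'; rw [e2] at hY1
  have hβα : (b : ℝ) / nR a ≤ a / nR a := div_le_div_of_nonneg_right hba' (Nat.cast_nonneg _)
  have hxa : ((xc a (j + 1) : ℕ) : ℝ) ≤ a := by exact_mod_cast (corner_facts hba hj).2.2.2.2.2.2
  have r0 : ((xc a (j + 1) : ℕ) : ℝ) ≤ ((p 0 : ℤ) : ℝ) := by exact_mod_cast h0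
  have r0' : 10 * (((p 0 : ℤ) : ℝ) - ((xc a (j + 1) : ℕ) : ℝ)) + ((yc a b j : ℕ) : ℝ) + 1 ≤
      ((yc a b (j + 1) : ℕ) : ℝ) := by exact_mod_cast h0'
  have r1 : ((yc a b j : ℕ) : ℝ) ≤ ((p 1 : ℤ) : ℝ) := by exact_mod_cast h1
  have r1' : ((p 1 : ℤ) : ℝ) ≤ ((yc a b (j + 1) : ℕ) : ℝ) := by exact_mod_cast h1'
  have hℓ := cast_le_ell0 a b
  -- the comparison point `(x_{j+1}, W)`, `W = x_{j+1} b / a`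
  have key := infDist_segment_le_coord a b p (((xc a (j + 1) : ℕ) : ℝ) / a) (by positivity)
    (by rwa [div_le_one ha0])
  have es : ((xc a (j + 1) : ℕ) : ℝ) / a * a = ((xc a (j + 1) : ℕ) : ℝ) := by field_simp
  rw [es] at key
  have hW1 : ((xc a (j + 1) : ℕ) : ℝ) / a * b ≤ (j : ℝ) / nR a * b + b / nR a := by
    calc ((xc a (j + 1) : ℕ) : ℝ) / a * b = ((xc a (j + 1) : ℕ) : ℝ) * (b / a) := by ring
      _ ≤ ((j : ℝ) / nR a * a + a / nR a) * (b / a) := mul_le_mul_of_nonneg_right hX1 (by positivity)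
      _ = (j : ℝ) / nR a * b + b / nR a := by field_simp
  have hW2 : (j : ℝ) / nR a * b + b / nR a - 1 ≤ ((xc a (j + 1) : ℕ) : ℝ) / a * b := by
    have hba1 : (b : ℝ) / a ≤ 1 := by rwa [div_le_one ha0]
    calc (j : ℝ) / nR a * b + b / nR a - 1 ≤ (j : ℝ) / nR a * b + b / nR a - b / a := by linarith
      _ = ((j : ℝ) / nR a * a + a / nR a - 1) * (b / a) := by field_simp
      _ ≤ ((xc a (j + 1) : ℕ) : ℝ) * (b / a) := mul_le_mul_of_nonneg_right hX1'.le (by positivity)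
      _ = ((xc a (j + 1) : ℕ) : ℝ) / a * b := by ring
  refine key.trans ?_
  have A : |((p 0 : ℤ) : ℝ) - ((xc a (j + 1) : ℕ) : ℝ)| ≤ (a : ℝ) / nR a / 10 := by
    rw [abs_le]; constructor <;> linarith
  have B : |((p 1 : ℤ) : ℝ) - ((xc a (j + 1) : ℕ) : ℝ) / a * b| ≤ 1 + (a : ℝ) / nR a := by
    rw [abs_le]; constructor <;> linarith
  linarith

/-! ### The rounds -/

/-- The cost of one block, `γ = x_c · min(c, 1) · ℓ₀^{-C}`, lies in `[0, 1]` (`x_c = 1/μ ≤ 1`). -/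
theorem gamma_facts {C c : ℝ} (hC : 0 ≤ C) (hc : 0 < c) (a b : ℕ) :
    0 ≤ criticalFugacity * min c 1 *
        (max 1 (dist (Site.toComplex (0 : Site 2)) (Site.toComplex (![(a : ℤ), (b : ℤ)] : Site 2)))) ^ (-C) ∧
      criticalFugacity * min c 1 *
        (max 1 (dist (Site.toComplex (0 : Site 2)) (Site.toComplex (![(a : ℤ), (b : ℤ)] : Site 2)))) ^ (-C) ≤ 1 := by
  have h0 : 0 ≤ criticalFugacity * min c 1 := mul_nonneg criticalFugacity_pos.le (le_min hc.le zero_le_one)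
  have hx : criticalFugacity ≤ 1 := by
    have h := Zd.one_le_connectiveConstant 2
    rw [Zd.connectiveConstant_two] at h
    exact inv_le_one_of_one_le₀ h
  refine ⟨mul_nonneg h0 (Real.rpow_nonneg (by positivity) _), (mul_le_of_le_one_right h0
    (Real.rpow_le_one_of_one_le_of_nonpos (le_max_left _ _) (by linarith))).trans ?_⟩
  exact mul_le_one₀ hx (le_min hc.le zero_le_one) (min_le_right _ _)

/-- **One round.**  A floor `B` for the staircase walks to `Q_j` (confined to `stairSet j ∩ tube`) gives the floor
`B γ²` at `Q_{j+1}`: glue the horizontal block of round `j + 1` (to `(x_{j+1}, y_j)`, region `midSet j`) and, if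
`y_{j+1} > y_j`, the vertical block (to `Q_{j+1}`) by `tubeMass_concat`; each block has mass `≥ γ ≤ 1`. -/
theorem round_step {C c : ℝ} (hC : 0 ≤ C) (hc : 0 < c)
    (h : ∀ L : ℕ, 1 ≤ L → ∃ N : ℕ, c * (L : ℝ) ^ (-C) ≤ ∑ n ∈ Finset.range (N + 1),
      ∑ _ω ∈ (Zd.sawFun 2 n ![(L : ℤ), 0]).filter (fun ω =>
          ∀ i ≤ n, 0 ≤ ω i 0 ∧ ω i 0 ≤ (L : ℤ) ∧ 0 ≤ ω i 1 ∧ 10 * ω i 1 ≤ (L : ℤ)),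
        criticalFugacity ^ n)
    {a b j : ℕ} (hba : b ≤ a) (hj : j + 1 ≤ nR a) {B : ℝ} (hB : 0 ≤ B) {N : ℕ}
    (hN : B ≤ ∑ n ∈ Finset.range (N + 1),
      ∑ _ω ∈ (Zd.sawFun 2 n ![((xc a j : ℕ) : ℤ), ((yc a b j : ℕ) : ℤ)]).filter
        (fun ω => ∀ i ≤ n, ω i ∈ stairSet a b j ∧ ω i ∈ tubeSet a b), criticalFugacity ^ n) :
    ∃ N' : ℕ, B * (criticalFugacity * min c 1 *
        (max 1 (dist (Site.toComplex (0 : Site 2)) (Site.toComplex (![(a : ℤ), (b : ℤ)] : Site 2)))) ^ (-C)) ^ 2 ≤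
      ∑ n ∈ Finset.range (N' + 1),
        ∑ _ω ∈ (Zd.sawFun 2 n ![((xc a (j + 1) : ℕ) : ℤ), ((yc a b (j + 1) : ℕ) : ℤ)]).filter
          (fun ω => ∀ i ≤ n, ω i ∈ stairSet a b (j + 1) ∧ ω i ∈ tubeSet a b), criticalFugacity ^ n := by
  obtain ⟨hq1, hqa, hx1, hx2, hy1, hy2, hxa⟩ := corner_facts hba hj
  have hℓ1 : (1 : ℝ) ≤ max 1 (dist (Site.toComplex (0 : Site 2))
      (Site.toComplex (![(a : ℤ), (b : ℤ)] : Site 2))) := le_max_left _ _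
  have haℓ := cast_le_ell0 a b
  obtain ⟨hγ0, hγ1⟩ := gamma_facts hC hc a b
  set γ := criticalFugacity * min c 1 *
    (max 1 (dist (Site.toComplex (0 : Site 2)) (Site.toComplex (![(a : ℤ), (b : ℤ)] : Site 2)))) ^ (-C) with hγ
  have hc1 : 0 ≤ min c 1 := le_min hc.le zero_le_one
  -- every block of parameter `L ≤ a` has mass `≥ γ`
  have hblock : ∀ L : ℕ, L ≤ a → γ ≤ criticalFugacity * min c 1 * (max 1 (L : ℝ)) ^ (-C) := by
    intro L hL
    refine mul_le_mul_of_nonneg_left ?_ (mul_nonneg criticalFugacity_pos.le hc1)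
    refine Real.rpow_le_rpow_of_nonpos (by positivity) (max_le hℓ1 ?_) (by linarith)
    exact le_trans (by exact_mod_cast hL) haℓ
  -- the horizontal block of round `j + 1`, parameter `x_{j+1} - x_j - 1`
  obtain ⟨N₂, hN₂⟩ := blockH_floor hc h (xc a (j + 1) - xc a j - 1)
  have hA := tubeMass_concat
    (P := fun p : Site 2 => p ∈ stairSet a b j ∧ p ∈ tubeSet a b)
    (Q := fun q : Site 2 => (0 ≤ q 0 ∧ q 0 ≤ ((xc a (j + 1) - xc a j - 1 : ℕ) : ℤ) ∧ 0 ≤ q 1 ∧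
        10 * q 1 ≤ ((xc a (j + 1) - xc a j - 1 : ℕ) : ℤ)) ∨
      (q 0 = ((xc a (j + 1) - xc a j - 1 : ℕ) : ℤ) + 1 ∧ q 1 = 0))
    (R := fun p : Site 2 => p ∈ midSet a b j ∧ p ∈ tubeSet a b)
    (e₁ := ![((xc a j : ℕ) : ℤ), ((yc a b j : ℕ) : ℤ)])
    (e₂ := ![((xc a (j + 1) - xc a j - 1 : ℕ) : ℤ) + 1, 0])
    (e := ![((xc a (j + 1) : ℕ) : ℤ), ((yc a b j : ℕ) : ℤ)])
    (site_ext (by simp only [Pi.add_apply, Matrix.cons_val_zero]; omega) (by simp))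
    (fun p hp => ⟨?hPA, hp.2⟩) ?hQA ?hsA N N₂
  case hPA =>
    have h1 := hp.1
    simp only [stairSet, midSet, Set.mem_setOf_eq] at h1 ⊢
    omega
  case hQA =>
    intro q hq
    have c0 : (![((xc a j : ℕ) : ℤ), ((yc a b j : ℕ) : ℤ)] + q) 0 = xc a j + q 0 := by simp
    have c1 : (![((xc a j : ℕ) : ℤ), ((yc a b j : ℕ) : ℤ)] + q) 1 = yc a b j + q 1 := by simp
    refine ⟨?_, tube_of_H hj (by rw [c0]; omega) (by rw [c0]; omega) (by rw [c1]; omega)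
      (by rw [c1]; omega)⟩
    simp only [midSet, Set.mem_setOf_eq, c0, c1]
    omega
  case hsA =>
    intro p q hp hq h0 h1
    have hp1 := hp.1
    simp only [stairSet, Set.mem_setOf_eq] at hp1
    simp only [Matrix.cons_val_zero, Matrix.cons_val_one] at h0 h1
    omega
  have hA' := le_trans (mul_le_mul hN ((hblock _ (by omega)).trans hN₂) hγ0 (hB.trans hN)) hA
  rcases Nat.eq_or_lt_of_le hy1 with hy | hy
  · -- no vertical block: `y_{j+1} = y_j`
    refine ⟨N + N₂, ?_⟩
    rw [← hy]
    calc B * γ ^ 2 ≤ B * γ := mul_le_mul_of_nonneg_left (pow_le_of_le_one hγ0 hγ1 two_ne_zero) hB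
      _ ≤ _ := hA'
      _ ≤ _ := tubeMass_mono (P := fun p : Site 2 => p ∈ midSet a b j ∧ p ∈ tubeSet a b)
          (R := fun p : Site 2 => p ∈ stairSet a b (j + 1) ∧ p ∈ tubeSet a b)
          (fun p hp => ⟨?_, hp.2⟩) _ _
    have h1 := hp.1
    simp only [midSet, stairSet, Set.mem_setOf_eq] at h1 ⊢
    omega
  · -- the vertical block of round `j + 1`, parameter `y_{j+1} - y_j - 1`
    obtain ⟨N₃, hN₃⟩ := blockV_floor hc h (yc a b (j + 1) - yc a b j - 1)
    have hV := tubeMass_concat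
      (P := fun p : Site 2 => p ∈ midSet a b j ∧ p ∈ tubeSet a b)
      (Q := fun q : Site 2 => (0 ≤ q 1 ∧ q 1 ≤ ((yc a b (j + 1) - yc a b j - 1 : ℕ) : ℤ) ∧ 0 ≤ q 0 ∧
          10 * q 0 ≤ ((yc a b (j + 1) - yc a b j - 1 : ℕ) : ℤ)) ∨
        (q 1 = ((yc a b (j + 1) - yc a b j - 1 : ℕ) : ℤ) + 1 ∧ q 0 = 0))
      (R := fun p : Site 2 => p ∈ stairSet a b (j + 1) ∧ p ∈ tubeSet a b)
      (e₁ := ![((xc a (j + 1) : ℕ) : ℤ), ((yc a b j : ℕ) : ℤ)])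
      (e₂ := ![0, ((yc a b (j + 1) - yc a b j - 1 : ℕ) : ℤ) + 1])
      (e := ![((xc a (j + 1) : ℕ) : ℤ), ((yc a b (j + 1) : ℕ) : ℤ)])
      (site_ext (by simp) (by simp only [Pi.add_apply, Matrix.cons_val_one, Matrix.cons_val_zero]; omega))
      (fun p hp => ⟨?hPV, hp.2⟩) ?hQV ?hsV (N + N₂) N₃
    case hPV =>
      have h1 := hp.1
      simp only [midSet, stairSet, Set.mem_setOf_eq] at h1 ⊢
      omega
    case hQV =>
      intro q hq
      have c0 : (![((xc a (j + 1) : ℕ) : ℤ), ((yc a b j : ℕ) : ℤ)] + q) 0 = xc a (j + 1) + q 0 := by simp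
      have c1 : (![((xc a (j + 1) : ℕ) : ℤ), ((yc a b j : ℕ) : ℤ)] + q) 1 = yc a b j + q 1 := by simp
      refine ⟨?_, tube_of_V hba hj (by rw [c0]; omega) (by rw [c0]; omega) (by rw [c1]; omega)
        (by rw [c1]; omega)⟩
      simp only [stairSet, Set.mem_setOf_eq, c0, c1]
      omega
    case hsV =>
      intro p q hp hq h0 h1
      have hp1 := hp.1
      simp only [midSet, Set.mem_setOf_eq] at hp1
      simp only [Matrix.cons_val_zero, Matrix.cons_val_one] at h0 h1
      omega
    refine ⟨N + N₂ + N₃, ?_⟩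
    calc B * γ ^ 2 = (B * γ) * γ := by ring
      _ ≤ _ := mul_le_mul hA' ((hblock _ (by omega)).trans hN₃) hγ0 (le_trans (by positivity) hA')
      _ ≤ _ := hV

end CornerStaircase

/-! ### The stub -/

open CornerStaircase in
/-- **Stub S4b of the line `lieb-simon-star`: the corner staircase.**  One-sided flat pieces
(`HalfTubePieceFloor`) and their coordinate-swapped vertical copies, glued through the corners
`(⌊j a/n⌋, ⌊j b/n⌋)`, `n = min(20, a)`, give for every `0 ≤ b ≤ a` tube-confined self-avoiding walks
`0 → (a, b)` of `x_c`-mass `≥ (x_c min(c,1))^{40} ℓ₀^{-40 C}`, `ℓ₀ = max(1, |(a,b)|)`: `FirstOctantTubeFloor`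
with `C' = 40 C`, `c' = (x_c min(c, 1))^{40}`. -/
theorem stub_cornerStaircase : HalfTubePieceFloor → FirstOctantTubeFloor := by
  rintro ⟨C, c, hC, hc, h⟩
  refine ⟨40 * C, (criticalFugacity * min c 1) ^ 40, by positivity,
    pow_pos (mul_pos criticalFugacity_pos (lt_min hc one_pos)) 40, fun a b hba => ?_⟩
  obtain ⟨hγ0, hγ1⟩ := gamma_facts hC hc a b
  set ℓ₀ := max 1 (dist (Site.toComplex (0 : Site 2)) (Site.toComplex (![(a : ℤ), (b : ℤ)] : Site 2)))
  set γ := criticalFugacity * min c 1 * ℓ₀ ^ (-C)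
  -- induction over the rounds
  have claim : ∀ j, j ≤ nR a → ∃ N : ℕ, (γ ^ 2) ^ j ≤ ∑ n ∈ Finset.range (N + 1),
      ∑ _ω ∈ (Zd.sawFun 2 n ![((xc a j : ℕ) : ℤ), ((yc a b j : ℕ) : ℤ)]).filter
        (fun ω => ∀ i ≤ n, ω i ∈ stairSet a b j ∧ ω i ∈ tubeSet a b), criticalFugacity ^ n := by
    intro j
    induction j with
    | zero =>
      intro _
      refine ⟨0, ?_⟩
      rw [pow_zero]
      refine one_le_tubeMass_zero (P := fun p : Site 2 => p ∈ stairSet a b 0 ∧ p ∈ tubeSet a b)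
        ⟨?_, zero_mem_tubeSet a b⟩ (site_ext (by simp [xc]) (by simp [yc])) 0
      simp [stairSet, xc, yc]
    | succ j ih =>
      intro hj
      obtain ⟨N, hN⟩ := ih (by omega)
      obtain ⟨N', hN'⟩ := round_step hC hc h hba hj (by positivity) hN
      exact ⟨N', by rw [pow_succ]; exact hN'⟩
  obtain ⟨N, hN⟩ := claim (nR a) le_rfl
  rw [(xc_yc_nR hba).1, (xc_yc_nR hba).2] at hN
  refine ⟨N, le_trans ?_ (hN.trans ?_)⟩
  · have hℓ0 : 0 < ℓ₀ := by positivity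
    have e : ℓ₀ ^ (-(40 * C)) = (ℓ₀ ^ (-C)) ^ (40 : ℕ) := by
      rw [← Real.rpow_natCast, ← Real.rpow_mul hℓ0.le]
      congr 1; push_cast; ring
    calc (criticalFugacity * min c 1) ^ 40 * ℓ₀ ^ (-(40 * C)) = (γ ^ 2) ^ 20 := by
          rw [e, ← mul_pow, ← pow_mul]
      _ ≤ (γ ^ 2) ^ nR a := pow_le_pow_of_le_one (by positivity) (pow_le_one₀ hγ0 hγ1) (min_le_left 20 a)
  · exact tubeMass_mono (P := fun p : Site 2 => p ∈ stairSet a b (nR a) ∧ p ∈ tubeSet a b)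
      (R := fun p : Site 2 => Metric.infDist (Site.toComplex p)
          (segment ℝ (Site.toComplex (0 : Site 2)) (Site.toComplex (![(a : ℤ), (b : ℤ)] : Site 2))) ≤
        max 1 (dist (Site.toComplex (0 : Site 2)) (Site.toComplex (![(a : ℤ), (b : ℤ)] : Site 2))) / 10 + 2)
      (fun p hp => hp.2) N _

end Summit.CriticalPhenomena.SAWScalingLimit.Theorems.TubeLowerBound.LiebSimonStar

end
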